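import Summits.ValiantsHypothesis.ValiantsHypothesis.Theorems.BarrierLeverTransversalMinorLayoutsEightFaces

/-!
# Route BarrierLever — item `TransversalLayoutsRankLeEight` (stmt-ValiantsHypothesis-19933):
# eight faces without vertices of degree one or two — the solid triangle

Helper file (`--supports stmt-ValiantsHypothesis-19933`; cell valiant-natproofs, rung V4, 𝒟-side of
door (c); seat val-np-p1 gen 8).  `lowerFamily_eight_no_degree_one_two`: a lower family of
exactly eight sets in which no element lies in exactly one or exactly two members is a SOLID
TRIANGLE — all members are subsets of one three-element set (hence, by cardinality, all of them).
Partner classification for the locked cells `(6, 8)` and `(5, 8)`.  Proof: a member with three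
elements makes the family a power set; otherwise a pair member `{a, b}` exists, `a`, `b` lie in
further pairs `{a, c}`, `{b, d}`, the four outside members force `c = d`, and no fourth one exists.

WHAT THIS IS NOT: bookkeeping for a bounded-rank slice of TT; nothing on TT / item 19761 in
general, on crux stmt-ValiantsHypothesis-14610, or on `VP` versus `VNP`.
-/

-- layout Summits/ValiantsHypothesis/ValiantsHypothesis forces the duplicated namespace component
set_option linter.dupNamespace false

open Matrix Finset

namespace Summit.ValiantsHypothesis.ValiantsHypothesis.Theorems.BarrierLever.FiniteCheck

open Summit.ValiantsHypothesis.ValiantsHypothesis.Theorems.BarrierLever.Compression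

/-- A lower family of exactly eight sets in which no element lies in exactly one or exactly two
members is a SOLID TRIANGLE: all members are subsets of one three-element set `{a, b, c}`. -/
theorem lowerFamily_eight_no_degree_one_two {h : ℕ} (F : Finset (Finset (Fin h)))
    (hlow : ∀ x ∈ F, ∀ t, t ⊆ x → t ∈ F) (hF : F.card = 8)
    (hdeg1 : ∀ c : Fin h, (F.filter fun x => c ∈ x).card ≠ 1)
    (hdeg2 : ∀ c : Fin h, (F.filter fun x => c ∈ x).card ≠ 2) :
    ∃ a b c : Fin h, a ≠ b ∧ a ≠ c ∧ b ≠ c ∧ ∀ y ∈ F, y ⊆ {a, b, c} := by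
  classical
  -- either some member has three elements (then F is a power set), or F is a graph
  by_cases hbig : ∃ x ∈ F, 3 ≤ x.card
  · obtain ⟨x, hx, hx3⟩ := hbig
    obtain ⟨S, hS3, hFS⟩ := eq_powerset_of_three_le_card F hlow (by omega) x hx hx3
    obtain ⟨a, b, c, hab, hac, hbc, rfl⟩ := Finset.card_eq_three.mp hS3
    refine ⟨a, b, c, hab, hac, hbc, fun y hy => ?_⟩
    rw [hFS, Finset.mem_powerset] at hy
    exact hy
  · exfalso
    push Not at hbig
    have hle2 : ∀ x ∈ F, x.card ≤ 2 := fun x hx => by have := hbig x hx; omega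
    obtain ⟨hpairOf, x, hxF, hx2⟩ := exists_pair_of_no_degree_one' F hlow hle2 (by omega) hdeg1
    obtain ⟨a, b, hab, rfl⟩ := Finset.card_eq_two.mp hx2
    obtain ⟨hPF, hPcard, hsing⟩ := pair_frame F hlow a b hab hxF
    -- a second pair through `a` and through `b` (degree ≠ 2)
    have hsecond : ∀ v v' : Fin h, v ≠ v' → ({v, v'} : Finset (Fin h)) ∈ F →
        ∃ c : Fin h, c ≠ v ∧ c ≠ v' ∧ ({v, c} : Finset (Fin h)) ∈ F := by
      intro v v' hvv' hvF
      have hvF1 : ({v} : Finset (Fin h)) ∈ F := hlow _ hvF _ (by simp)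
      have hsub : ({{v}, {v, v'}} : Finset (Finset (Fin h))) ⊆ F.filter fun x => v ∈ x := by
        intro t ht
        simp only [Finset.mem_insert, Finset.mem_singleton] at ht
        rcases ht with rfl | rfl
        · exact Finset.mem_filter.mpr ⟨hvF1, by simp⟩
        · exact Finset.mem_filter.mpr ⟨hvF, by simp⟩
      have h2 : ({{v}, {v, v'}} : Finset (Finset (Fin h))).card = 2 := by
        rw [Finset.card_pair]
        intro e
        have : v' ∈ ({v} : Finset (Fin h)) := by rw [e]; simp
        exact hvv' (Finset.mem_singleton.mp this).symm
      obtain ⟨y, hy, hyn⟩ : ∃ y ∈ F.filter (fun x => v ∈ x),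
          y ∉ ({{v}, {v, v'}} : Finset (Finset (Fin h))) := by
        by_contra hno
        push Not at hno
        have hle := Finset.card_le_card (show (F.filter fun x => v ∈ x) ⊆ {{v}, {v, v'}} from hno)
        have hge := Finset.card_le_card hsub
        rw [h2] at hle hge
        exact hdeg2 v (le_antisymm hle hge)
      rw [Finset.mem_filter] at hy
      obtain ⟨hyF, hvy⟩ := hy
      simp only [Finset.mem_insert, Finset.mem_singleton, not_or] at hyn
      have hy2 : y.card = 2 := by
        have := hle2 y hyF
        rcases Nat.lt_or_ge y.card 2 with hlt' | hge
        · exfalso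
          have hy1 : y.card ≤ 1 := by omega
          exact hyn.1 (Finset.eq_singleton_iff_unique_mem.mpr ⟨hvy, fun e he =>
            Finset.card_le_one.mp hy1 e he v hvy⟩)
        · omega
      obtain ⟨c, hc⟩ := Finset.card_eq_one.mp
        (show (y.erase v).card = 1 by rw [Finset.card_erase_of_mem hvy, hy2])
      have hcy : c ∈ y.erase v := by rw [hc]; simp
      obtain ⟨hcv, hcy'⟩ := Finset.mem_erase.mp hcy
      have hyeq : y = {v, c} := by rw [← Finset.insert_erase hvy, hc]
      refine ⟨c, hcv, fun e => hyn.2 (by rw [hyeq, e]), hyeq ▸ hyF⟩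
    obtain ⟨c, hca, hcb, hacF⟩ := hsecond a b hab hxF
    obtain ⟨d, hdb, hda, hbdF⟩ := hsecond b a hab.symm (by rw [Finset.pair_comm]; exact hxF)
    have hcF : ({c} : Finset (Fin h)) ∈ F := hlow _ hacF _ (by simp)
    have hdF : ({d} : Finset (Fin h)) ∈ F := hlow _ hbdF _ (by simp)
    set P : Finset (Finset (Fin h)) := {∅, {a}, {b}, {a, b}} with hPdef
    have hPmem : ∀ y, y ∈ P ↔ y = ∅ ∨ y = {a} ∨ y = {b} ∨ y = {a, b} := by
      intro y; simp only [hPdef, Finset.mem_insert, Finset.mem_singleton]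
    have hdiff : (F \ P).card = 4 := by
      rw [Finset.card_sdiff_of_subset hPF, hF, hPcard]
    have hout_pair : ∀ v v' e : Fin h, v ≠ v' → e ≠ v → e ≠ v' →
        ({v, v'} : Finset (Fin h)) = {a, b} → ({v, e} : Finset (Fin h)) ∈ F →
        ({v, e} : Finset (Fin h)) ∈ F \ P := by
      intro v v' e hvv' hev hev' hvv hveF
      rw [Finset.mem_sdiff, hPmem]
      refine ⟨hveF, ?_⟩
      have hv : v = a ∨ v = b := by
        have : v ∈ ({a, b} : Finset (Fin h)) := by rw [← hvv]; simp
        simpa using this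
      have hv' : v' = a ∨ v' = b := by
        have : v' ∈ ({a, b} : Finset (Fin h)) := by rw [← hvv]; simp
        simpa using this
      have hea : e ≠ a := by
        rintro rfl
        rcases hv with rfl | rfl
        · exact hev rfl
        · rcases hv' with rfl | rfl
          · exact hev' rfl
          · exact hvv' rfl
      have heb : e ≠ b := by
        rintro rfl
        rcases hv with rfl | rfl
        · rcases hv' with rfl | rfl
          · exact hvv' rfl
          · exact hev' rfl
        · exact hev rfl
      simp only [not_or]
      refine ⟨?_, ?_, ?_, ?_⟩
      · intro e'; have : e ∈ (∅ : Finset (Fin h)) := by rw [← e']; simp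
        simp at this
      · intro e'; have : e ∈ ({a} : Finset (Fin h)) := by rw [← e']; simp
        exact hea (Finset.mem_singleton.mp this)
      · intro e'; have : e ∈ ({b} : Finset (Fin h)) := by rw [← e']; simp
        exact heb (Finset.mem_singleton.mp this)
      · intro e'; have : e ∈ ({a, b} : Finset (Fin h)) := by rw [← e']; simp
        simp only [Finset.mem_insert, Finset.mem_singleton] at this
        rcases this with e'' | e''
        · exact hea e''
        · exact heb e''
    have hout_ac : ({a, c} : Finset (Fin h)) ∈ F \ P := hout_pair a b c hab hca hcb rfl hacF
    have hout_bd : ({b, d} : Finset (Fin h)) ∈ F \ P :=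
      hout_pair b a d hab.symm hdb hda (Finset.pair_comm b a) hbdF
    have hout_sing : ∀ e : Fin h, e ≠ a → e ≠ b → ({e} : Finset (Fin h)) ∈ F →
        ({e} : Finset (Fin h)) ∈ F \ P := by
      intro e hea heb heF
      rw [Finset.mem_sdiff]
      refine ⟨heF, fun hP => ?_⟩
      rcases hsing e hP with e' | e'
      · exact hea e'
      · exact heb e'
    have hcd : c = d := by
      by_contra hcd
      have hsub : ({{a, c}, {b, d}, {c}, {d}} : Finset (Finset (Fin h))) ⊆ F \ P := by
        intro t ht
        simp only [Finset.mem_insert, Finset.mem_singleton] at ht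
        rcases ht with rfl | rfl | rfl | rfl
        · exact hout_ac
        · exact hout_bd
        · exact hout_sing c hca hcb hcF
        · exact hout_sing d hda hdb hdF
      have h4 : ({{a, c}, {b, d}, {c}, {d}} : Finset (Finset (Fin h))).card = 4 := by
        have n1 : ({a, c} : Finset (Fin h)) ∉ ({{b, d}, {c}, {d}} : Finset (Finset (Fin h))) := by
          simp only [Finset.mem_insert, Finset.mem_singleton, not_or]
          refine ⟨fun e => ?_, fun e => ?_, fun e => ?_⟩
          · have : a ∈ ({b, d} : Finset (Fin h)) := by rw [← e]; simp
            simp only [Finset.mem_insert, Finset.mem_singleton] at this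
            rcases this with e' | e'
            · exact hab e'
            · exact hda e'.symm
          · have := congrArg Finset.card e
            rw [Finset.card_pair (fun e' => hca e'.symm), Finset.card_singleton] at this; omega
          · have := congrArg Finset.card e
            rw [Finset.card_pair (fun e' => hca e'.symm), Finset.card_singleton] at this; omega
        have n2 : ({b, d} : Finset (Fin h)) ∉ ({{c}, {d}} : Finset (Finset (Fin h))) := by
          simp only [Finset.mem_insert, Finset.mem_singleton, not_or]
          refine ⟨fun e => ?_, fun e => ?_⟩
          · have := congrArg Finset.card e
            rw [Finset.card_pair (fun e' => hdb e'.symm), Finset.card_singleton] at this; omega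
          · have := congrArg Finset.card e
            rw [Finset.card_pair (fun e' => hdb e'.symm), Finset.card_singleton] at this; omega
        have n3 : ({c} : Finset (Fin h)) ≠ {d} := fun e => hcd (Finset.singleton_injective e)
        rw [Finset.card_insert_of_notMem n1, Finset.card_insert_of_notMem n2, Finset.card_pair n3]
      have hT : F \ P = {{a, c}, {b, d}, {c}, {d}} :=
        (Finset.eq_of_subset_of_card_le hsub (by rw [h4, hdiff])).symm
      -- the members containing `c`: `{a, c}` and `{c}` only
      apply hdeg2 c
      have : (F.filter fun y => c ∈ y) = {{a, c}, {c}} := by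
        ext y
        simp only [Finset.mem_filter, Finset.mem_insert, Finset.mem_singleton]
        constructor
        · rintro ⟨hyF, hcy⟩
          by_cases hyP : y ∈ P
          · exfalso
            rcases (hPmem y).mp hyP with rfl | rfl | rfl | rfl
            · simp at hcy
            · exact hca (Finset.mem_singleton.mp hcy)
            · exact hcb (Finset.mem_singleton.mp hcy)
            · simp only [Finset.mem_insert, Finset.mem_singleton] at hcy
              rcases hcy with e | e
              · exact hca e
              · exact hcb e
          · have hyT : y ∈ F \ P := Finset.mem_sdiff.mpr ⟨hyF, hyP⟩
            rw [hT] at hyT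
            simp only [Finset.mem_insert, Finset.mem_singleton] at hyT
            rcases hyT with rfl | rfl | rfl | rfl
            · exact Or.inl rfl
            · exfalso
              simp only [Finset.mem_insert, Finset.mem_singleton] at hcy
              rcases hcy with e | e
              · exact hcb e
              · exact hcd e
            · exact Or.inr rfl
            · exfalso; exact hcd (Finset.mem_singleton.mp hcy)
        · rintro (rfl | rfl)
          · exact ⟨hacF, by simp⟩
          · exact ⟨hcF, by simp⟩
      rw [this, Finset.card_pair]
      intro e
      have := congrArg Finset.card e
      rw [Finset.card_pair hca.symm, Finset.card_singleton] at this
      omega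
    subst hcd
    -- now the outsiders contain `{c}`, `{a,c}`, `{b,c}`; the fourth outsider is impossible
    have hT3 : ({{c}, {a, c}, {b, c}} : Finset (Finset (Fin h))) ⊆ F \ P := by
      intro t ht
      simp only [Finset.mem_insert, Finset.mem_singleton] at ht
      rcases ht with rfl | rfl | rfl
      · exact hout_sing c hca hcb hcF
      · exact hout_ac
      · exact hout_bd
    have h3 : ({{c}, {a, c}, {b, c}} : Finset (Finset (Fin h))).card = 3 := by
      have n1 : ({c} : Finset (Fin h)) ∉ ({{a, c}, {b, c}} : Finset (Finset (Fin h))) := by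
        simp only [Finset.mem_insert, Finset.mem_singleton, not_or]
        refine ⟨fun e => ?_, fun e => ?_⟩
        · have := congrArg Finset.card e
          rw [Finset.card_pair (fun e' => hca e'.symm), Finset.card_singleton] at this; omega
        · have := congrArg Finset.card e
          rw [Finset.card_pair (fun e' => hcb e'.symm), Finset.card_singleton] at this; omega
      have n2 : ({a, c} : Finset (Fin h)) ≠ {b, c} := by
        intro e
        have : a ∈ ({b, c} : Finset (Fin h)) := by rw [← e]; simp
        simp only [Finset.mem_insert, Finset.mem_singleton] at this
        rcases this with e' | e'
        · exact hab e'
        · exact hca e'.symm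
      rw [Finset.card_insert_of_notMem n1, Finset.card_pair n2]
    -- a fourth outsider
    obtain ⟨t, ht⟩ : ∃ t, t ∈ (F \ P) \ {{c}, {a, c}, {b, c}} := by
      apply Finset.Nonempty.exists_mem
      rw [← Finset.card_pos, Finset.card_sdiff_of_subset hT3, hdiff, h3]
      omega
    rw [Finset.mem_sdiff, Finset.mem_sdiff] at ht
    obtain ⟨⟨htF, htP⟩, ht3⟩ := ht
    simp only [Finset.mem_insert, Finset.mem_singleton, not_or] at ht3
    have ht2 := hle2 t htF
    -- every element of `t` is one of a, b, c
    have helem : ∀ e ∈ t, e = a ∨ e = b ∨ e = c := by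
      intro e he
      have heF : ({e} : Finset (Fin h)) ∈ F := hlow t htF _ (Finset.singleton_subset_iff.mpr he)
      by_cases heP : ({e} : Finset (Fin h)) ∈ P
      · rcases hsing e heP with h' | h'
        · exact Or.inl h'
        · exact Or.inr (Or.inl h')
      · -- `{e}` would be a fifth outsider
        right; right
        by_contra hec
        have heT : ({e} : Finset (Fin h)) ∈ F \ P := Finset.mem_sdiff.mpr ⟨heF, heP⟩
        have hcard5 : ({{c}, {a, c}, {b, c}, t, {e}} : Finset (Finset (Fin h))) ⊆ F \ P := by
          intro s hs
          simp only [Finset.mem_insert, Finset.mem_singleton] at hs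
          rcases hs with rfl | rfl | rfl | rfl | rfl
          · exact hout_sing c hca hcb hcF
          · exact hout_ac
          · exact hout_bd
          · exact Finset.mem_sdiff.mpr ⟨htF, htP⟩
          · exact heT
        by_cases hte : t = {e}
        · obtain ⟨y, hyF, hey, hy2⟩ := hpairOf e heF
          have hyP : y ∉ P := by
            intro hyP
            rcases (hPmem y).mp hyP with rfl | rfl | rfl | rfl
            · simp at hey
            · simp at hy2
            · simp at hy2
            · simp only [Finset.mem_insert, Finset.mem_singleton] at hey
              rcases hey with e' | e'
              · exact heP (by rw [e', hPmem]; simp)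
              · exact heP (by rw [e', hPmem]; simp)
          have hyT : y ∈ F \ P := Finset.mem_sdiff.mpr ⟨hyF, hyP⟩
          have hsub6 : ({{c}, {a, c}, {b, c}, t, y} : Finset (Finset (Fin h))) ⊆ F \ P := by
            intro s hs
            simp only [Finset.mem_insert, Finset.mem_singleton] at hs
            rcases hs with rfl | rfl | rfl | rfl | rfl
            · exact hout_sing c hca hcb hcF
            · exact hout_ac
            · exact hout_bd
            · exact Finset.mem_sdiff.mpr ⟨htF, htP⟩
            · exact hyT
          have hy_ne : y ≠ {c} ∧ y ≠ {a, c} ∧ y ≠ {b, c} ∧ y ≠ t := by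
            refine ⟨fun e' => ?_, fun e' => ?_, fun e' => ?_, fun e' => ?_⟩
            · rw [e'] at hy2; simp at hy2
            · rw [e'] at hey
              simp only [Finset.mem_insert, Finset.mem_singleton] at hey
              rcases hey with e'' | e''
              · exact heP (by rw [e'', hPmem]; simp)
              · exact hec e''
            · rw [e'] at hey
              simp only [Finset.mem_insert, Finset.mem_singleton] at hey
              rcases hey with e'' | e''
              · exact heP (by rw [e'', hPmem]; simp)
              · exact hec e''
            · rw [e', hte] at hy2; simp at hy2
          have h5 : ({{c}, {a, c}, {b, c}, t, y} : Finset (Finset (Fin h))).card = 5 := by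
            have n0 : t ∉ ({y} : Finset (Finset (Fin h))) := by
              rw [Finset.mem_singleton]; exact fun e' => hy_ne.2.2.2 e'.symm
            rw [show ({{c}, {a, c}, {b, c}, t, y} : Finset (Finset (Fin h))) =
              insert {c} (insert {a, c} (insert {b, c} (insert t {y}))) from rfl]
            rw [Finset.card_insert_of_notMem, Finset.card_insert_of_notMem,
              Finset.card_insert_of_notMem, Finset.card_insert_of_notMem n0, Finset.card_singleton]
            · simp only [Finset.mem_insert, Finset.mem_singleton, not_or]
              exact ⟨fun e' => ht3.2.2 e'.symm, fun e' => hy_ne.2.2.1 e'.symm⟩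
            · simp only [Finset.mem_insert, Finset.mem_singleton, not_or]
              refine ⟨?_, fun e' => ht3.2.1 e'.symm, fun e' => hy_ne.2.1 e'.symm⟩
              intro e'
              have : a ∈ ({b, c} : Finset (Fin h)) := by rw [← e']; simp
              simp only [Finset.mem_insert, Finset.mem_singleton] at this
              rcases this with e'' | e''
              · exact hab e''
              · exact hca e''.symm
            · simp only [Finset.mem_insert, Finset.mem_singleton, not_or]
              refine ⟨?_, ?_, fun e' => ht3.1 e'.symm, fun e' => hy_ne.1 e'.symm⟩
              · intro e'
                have := congrArg Finset.card e'
                rw [Finset.card_singleton, Finset.card_pair (fun e'' => hca e''.symm)] at this; omega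
              · intro e'
                have := congrArg Finset.card e'
                rw [Finset.card_singleton, Finset.card_pair (fun e'' => hcb e''.symm)] at this; omega
          have := Finset.card_le_card hsub6
          rw [h5, hdiff] at this
          omega
        · have h5 : ({{c}, {a, c}, {b, c}, t, {e}} : Finset (Finset (Fin h))).card = 5 := by
            have n0 : t ∉ ({{e}} : Finset (Finset (Fin h))) := by
              rw [Finset.mem_singleton]; exact hte
            rw [show ({{c}, {a, c}, {b, c}, t, {e}} : Finset (Finset (Fin h))) =
              insert {c} (insert {a, c} (insert {b, c} (insert t {{e}}))) from rfl]
            rw [Finset.card_insert_of_notMem, Finset.card_insert_of_notMem,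
              Finset.card_insert_of_notMem, Finset.card_insert_of_notMem n0, Finset.card_singleton]
            · simp only [Finset.mem_insert, Finset.mem_singleton, not_or]
              refine ⟨fun e' => ht3.2.2 e'.symm, fun e' => ?_⟩
              have := congrArg Finset.card e'
              rw [Finset.card_pair (fun e'' => hcb e''.symm), Finset.card_singleton] at this; omega
            · simp only [Finset.mem_insert, Finset.mem_singleton, not_or]
              refine ⟨?_, fun e' => ht3.2.1 e'.symm, fun e' => ?_⟩
              · intro e'
                have : a ∈ ({b, c} : Finset (Fin h)) := by rw [← e']; simp
                simp only [Finset.mem_insert, Finset.mem_singleton] at this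
                rcases this with e'' | e''
                · exact hab e''
                · exact hca e''.symm
              · have := congrArg Finset.card e'
                rw [Finset.card_pair (fun e'' => hca e''.symm), Finset.card_singleton] at this; omega
            · simp only [Finset.mem_insert, Finset.mem_singleton, not_or]
              refine ⟨?_, ?_, fun e' => ht3.1 e'.symm, fun e' => hec (Finset.singleton_injective e'.symm)⟩
              · intro e'
                have := congrArg Finset.card e'
                rw [Finset.card_singleton, Finset.card_pair (fun e'' => hca e''.symm)] at this; omega
              · intro e'
                have := congrArg Finset.card e'
                rw [Finset.card_singleton, Finset.card_pair (fun e'' => hcb e''.symm)] at this; omega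
          have := Finset.card_le_card hcard5
          rw [h5, hdiff] at this
          omega
    -- so t ⊆ {a, b, c}, of size ≤ 2, hence one of the seven known members: contradiction
    rcases Nat.lt_or_ge t.card 1 with h0 | h1
    · apply htP
      rw [Finset.card_eq_zero.mp (show t.card = 0 by omega), hPmem]; simp
    rcases Nat.lt_or_ge t.card 2 with h1' | h2'
    · obtain ⟨e, rfl⟩ := Finset.card_eq_one.mp (show t.card = 1 by omega)
      rcases helem e (Finset.mem_singleton_self e) with rfl | rfl | rfl
      · exact htP (by rw [hPmem]; simp)
      · exact htP (by rw [hPmem]; simp)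
      · exact ht3.1 rfl
    · obtain ⟨p, q, hpq, rfl⟩ := Finset.card_eq_two.mp (le_antisymm ht2 h2')
      have hp := helem p (by simp)
      have hq := helem q (by simp)
      -- {p, q} ⊆ {a, b, c} with p ≠ q: it is {a,b}, {a,c} or {b,c}
      rcases hp with rfl | rfl | rfl <;> rcases hq with rfl | rfl | rfl
      · exact hpq rfl
      · exact htP (by rw [hPmem]; simp)
      · exact ht3.2.1 rfl
      · exact htP (by rw [hPmem]; simp [Finset.pair_comm])
      · exact hpq rfl
      · exact ht3.2.2 rfl
      · exact ht3.2.1 (Finset.pair_comm _ _)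
      · exact ht3.2.2 (Finset.pair_comm _ _)
      · exact hpq rfl


end Summit.ValiantsHypothesis.ValiantsHypothesis.Theorems.BarrierLever.FiniteCheck
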